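import Literature.NumberTheory.Automorphic.ArchUnipotentDilationGL2
import Literature.NumberTheory.Automorphic.MixedSpaceMomentKernels
import Literature.NumberTheory.Automorphic.MixedSpaceUnitsHaar
import Literature.NumberTheory.Automorphic.AdeleQuotientFourierDecay
import Mathlib.Analysis.Calculus.LineDeriv.IntegrationByParts
import Mathlib.Analysis.SpecialFunctions.JapaneseBracket
import Mathlib.Analysis.Calculus.BumpFunction.FiniteDimension
import Mathlib.Analysis.Calculus.BumpFunction.Normed
import Mathlib.Algebra.Order.Chebyshev
import HarnessLib

/-!
# Moment kernels on `K_∞`: the Fourier side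

Topic `NumberTheory/Automorphic`; namespace `Literature.NumberTheory.Automorphic`. Definitions with
bodies and theorems (no named fact). For a real kernel `g` on `K_∞ = mixedSpace K` let
`ĝ(ξ) = ∫ g(x) e^{i B(ξ, x)} dx` (`kernelTransform`), `B = archCharForm K = -2π Tr(ξ x)` the
bilinear form of Tate's archimedean character (`ArchUnipotentDilationGL2`). For the moment kernels
of `MixedSpaceMomentKernels` (`IsMomentKernel k g`: `≥ k w` place-pure derivatives at each place `w`)
we PROVE:

* `kernelTransform_fderiv` — **integration by parts**: `(∂_c g)^(ξ) = -i B(ξ, c) ĝ(ξ)`;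
* `IsMomentKernel.kernelTransform_eq_zero` — **vanishing along the coordinate hyperplanes**:
  `ĝ(ξ) = 0` whenever `ξ_w = 0` at a place with `k w ≥ 1` (for `c` supported at `w`, `B(ξ, c)`
  only sees `ξ_w`); hence `ĝ` vanishes at every non-unit of `K_∞` when `k ≥ 1` everywhere
  (`IsMomentKernel.kernelTransform_eq_zero_of_not_isUnit`) — the hypothesis of the dilation
  integral `lintegral_weight_mul_norm_sq_kirillovKernel_le`;
* `IsMomentKernel.kernelTransform_decay` — **place-wise decay**: for every `p`,
  `‖ĝ(ξ)‖ ∏_w max(1, |ξ_w|)^p ≤ C ∏_w min(1, |ξ_w|)^{k w}` (Schwartz decay of `ĥ` for `h ∈ C_c^∞`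
  by integration by parts along the coordinate directions, then one factor `|ξ_w|` per pure
  derivative at `w`);
* `placeWeight m ξ = ∏_w |ξ_w|^{m w}` (in `ℝ≥0∞`, multiplicative, measurable) and
  `lintegral_placeWeight_mul_norm_sq_kernelTransform_inv_lt_top` /
  `IsMomentKernel.lintegral_dilationConstant_lt_top` — **the dilation constant
  `∫_{K_∞ˣ} ∏_w |z_w|^{2 m_w} ‖ĝ(z⁻¹)‖² d^×z` is finite** for a moment kernel with `k w ≥ m w + 1`
  (pointwise domination on units by the integrable profile `∏_w 2^{d_w+1}(1+|x_w|)^{-(d_w+1)}`,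
  `d_w = mult w`, using the product structure of `volume` on `K_∞` and Mathlib's
  `integrable_one_add_norm`);
* `exists_isMomentKernelGE_kernelTransform_one_ne_zero` — **for every `M` there is a moment kernel
  of order `≥ M` at every place with `ĝ(1) ≠ 0`** (a small bump `h` around `0`, `Re ĥ(1) > 0`, then
  `M` pure coordinate derivatives at each place: `ĝ(1) = ∏_w (-iB(1, e_w))^M ĥ(1)` with
  `B(1, e_w) ∈ {-2π, -4π}`).

## References

* H. Jacquet, J. A. Shalika, *On Euler products and the classification of automorphic
  representations I*, Amer. J. Math. 103 (1981), §4 [JacquetShalikaAJM1981].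
* G. B. Folland, *A Course in Abstract Harmonic Analysis* (1995), §4.2–4.3 [Folland1995].
* J. Tate, Fourier analysis in number fields, in Cassels–Fröhlich (1967), Ch. XV §2.2
  [CasselsFrohlichANT1967].
-/

noncomputable section

open scoped Classical ContDiff Real ENNReal
open NumberField NumberField.mixedEmbedding NumberField.InfinitePlace MeasureTheory Complex

namespace Literature.NumberTheory.Automorphic

variable (K : Type) [Field K] [NumberField K]

/-! ### The character and the transform -/

/-- The bilinear form `B(ξ, ·)` of Tate's archimedean character as a continuous linear form. [folklore] -/
def archCharFormCLM (ξ : mixedSpace K) : mixedSpace K →L[ℝ] ℝ :=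
  ⟨archCharForm K ξ, LinearMap.continuous_of_finiteDimensional _⟩

/-- Unfolding of `archCharFormCLM`. [folklore] -/
@[simp]
theorem archCharFormCLM_apply (ξ x : mixedSpace K) : archCharFormCLM K ξ x = archCharForm K ξ x := rfl

/-- The unitary character `x ↦ e^{i B(ξ, x)}` of `K_∞`. [cite: CasselsFrohlichANT1967, Ch. XV §2.2] -/
def archChar (ξ x : mixedSpace K) : ℂ := cexp ((archCharForm K ξ x : ℝ) * I)

/-- `|e^{i B(ξ,x)}| = 1`. [folklore] -/
theorem norm_archChar (ξ x : mixedSpace K) : ‖archChar K ξ x‖ = 1 := norm_exp_ofReal_mul_I _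

/-- The exponent `x ↦ i B(ξ, x)` as a real-linear continuous map into `ℂ`. [folklore] -/
def archCharExpCLM (ξ : mixedSpace K) : mixedSpace K →L[ℝ] ℂ := I • ofRealCLM.comp (archCharFormCLM K ξ)

/-- Unfolding of `archCharExpCLM`. [folklore] -/
theorem archCharExpCLM_apply (ξ x : mixedSpace K) : archCharExpCLM K ξ x = (archCharForm K ξ x : ℝ) * I := by
  simp [archCharExpCLM, mul_comm]

/-- `archChar K ξ = cexp ∘ archCharExpCLM K ξ`. [folklore] -/
theorem archChar_eq (ξ : mixedSpace K) : archChar K ξ = fun x => cexp (archCharExpCLM K ξ x) := by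
  funext x; rw [archCharExpCLM_apply]; rfl

/-- The character is continuous. [folklore] -/
theorem continuous_archChar (ξ : mixedSpace K) : Continuous (archChar K ξ) := by
  rw [archChar_eq]
  exact continuous_exp.comp (archCharExpCLM K ξ).continuous

/-- **The derivative of the character**: `∂_c e^{iB(ξ,x)} = e^{iB(ξ,x)} · i B(ξ, c)`. [folklore] -/
theorem hasFDerivAt_archChar (ξ x : mixedSpace K) :
    HasFDerivAt (archChar K ξ) (archChar K ξ x • archCharExpCLM K ξ) x := by
  rw [archChar_eq]
  exact (archCharExpCLM K ξ).hasFDerivAt.cexp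

/-- The character is differentiable. [folklore] -/
theorem differentiable_archChar (ξ : mixedSpace K) : Differentiable ℝ (archChar K ξ) := fun x =>
  (hasFDerivAt_archChar K ξ x).differentiableAt

/-- The directional derivative of the character. [folklore] -/
theorem fderiv_archChar_apply (ξ x c : mixedSpace K) :
    fderiv ℝ (archChar K ξ) x c = archChar K ξ x * ((archCharForm K ξ c : ℝ) * I) := by
  rw [(hasFDerivAt_archChar K ξ x).fderiv, FunLike.coe_smul, Pi.smul_apply, archCharExpCLM_apply, smul_eq_mul]

/-- **The transform** `ĝ(ξ) = ∫ g(x) e^{i B(ξ, x)} dx` of a real kernel on `K_∞` with respect to Tate's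
archimedean character. [cite: CasselsFrohlichANT1967, Ch. XV §2.2] -/
def kernelTransform (g : mixedSpace K → ℝ) (ξ : mixedSpace K) : ℂ := ∫ x, (g x : ℂ) * archChar K ξ x

/-- Unfolding of `kernelTransform` in the currency of `lintegral_weight_mul_norm_sq_kirillovKernel_le`. [folklore] -/
theorem kernelTransform_eq (g : mixedSpace K → ℝ) (ξ : mixedSpace K) :
    kernelTransform K g ξ = ∫ x, (g x : ℂ) * cexp ((archCharForm K ξ x : ℝ) * I) := rfl

/-- `‖ĝ(ξ)‖ ≤ ∫ |g|`. [folklore] -/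
theorem norm_kernelTransform_le (g : mixedSpace K → ℝ) (ξ : mixedSpace K) : ‖kernelTransform K g ξ‖ ≤ ∫ x, |g x| := by
  refine (norm_integral_le_integral_norm _).trans (le_of_eq (integral_congr_ae (ae_of_all _ fun x => ?_)))
  simp only [norm_mul, norm_archChar, mul_one, Complex.norm_real, Real.norm_eq_abs]

/-- The transform integrand of a continuous compactly supported kernel is integrable. [folklore] -/
theorem integrable_kernelTransform_integrand {g : mixedSpace K → ℝ} (hg : Continuous g) (hgs : HasCompactSupport g)
    (ξ : mixedSpace K) : Integrable fun x => (g x : ℂ) * archChar K ξ x :=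
  ((continuous_ofReal.comp hg).mul (continuous_archChar K ξ)).integrable_of_hasCompactSupport
    (hgs.comp_left ofReal_zero).mul_right

/-- Additivity of the transform. [folklore] -/
theorem kernelTransform_add {g g' : mixedSpace K → ℝ} (hg : Continuous g) (hgs : HasCompactSupport g)
    (hg' : Continuous g') (hgs' : HasCompactSupport g') (ξ : mixedSpace K) :
    kernelTransform K (g + g') ξ = kernelTransform K g ξ + kernelTransform K g' ξ := by
  simp only [kernelTransform, Pi.add_apply, ofReal_add, add_mul]
  exact integral_add (integrable_kernelTransform_integrand K hg hgs ξ) (integrable_kernelTransform_integrand K hg' hgs' ξ)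

/-- Homogeneity of the transform. [folklore] -/
theorem kernelTransform_smul (a : ℝ) (g : mixedSpace K → ℝ) (ξ : mixedSpace K) :
    kernelTransform K (a • g) ξ = (a : ℂ) * kernelTransform K g ξ := by
  simp only [kernelTransform, Pi.smul_apply, smul_eq_mul, ofReal_mul, mul_assoc, integral_const_mul]

/-- The transform of the zero kernel. [folklore] -/
@[simp]
theorem kernelTransform_zero (ξ : mixedSpace K) : kernelTransform K 0 ξ = 0 := by
  simp [kernelTransform]

/-! ### Integration by parts -/

/-- The directional derivative of a `C^∞` function is `C^∞`. [folklore] -/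
theorem contDiff_fderiv_dir {g : mixedSpace K → ℝ} (hg : ContDiff ℝ ∞ g) (c : mixedSpace K) :
    ContDiff ℝ ∞ fun x => fderiv ℝ g x c :=
  (hg.fderiv_right le_rfl).clm_apply contDiff_const

omit [NumberField K] in
/-- The directional derivative of a compactly supported function is compactly supported. [folklore] -/
theorem hasCompactSupport_fderiv_dir {g : mixedSpace K → ℝ} (hgs : HasCompactSupport g) (c : mixedSpace K) :
    HasCompactSupport fun x => fderiv ℝ g x c := by
  refine hgs.fderiv (𝕜 := ℝ) |>.mono ?_
  intro x hx
  rw [Function.mem_support] at hx ⊢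
  intro h0
  exact hx (by rw [h0]; rfl)

/-- The complexified kernel has directional derivative `(∂_c g : ℂ)`. [folklore] -/
theorem fderiv_ofReal_comp_apply {g : mixedSpace K → ℝ} (hg : Differentiable ℝ g) (x c : mixedSpace K) :
    fderiv ℝ (fun x => (g x : ℂ)) x c = ((fderiv ℝ g x c : ℝ) : ℂ) := by
  have h := ofRealCLM.hasFDerivAt.comp x (hg x).hasFDerivAt
  rw [show (fun x => (g x : ℂ)) = ofRealCLM ∘ g from rfl, h.fderiv]
  rfl

/-- **Integration by parts**: `(∂_c g)^(ξ) = -i B(ξ, c) · ĝ(ξ)` for a `C^∞` compactly supported real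
kernel. [cite: Folland1995, Thm. 4.3 / (4.24)] -/
theorem kernelTransform_fderiv {g : mixedSpace K → ℝ} (hg : ContDiff ℝ ∞ g) (hgs : HasCompactSupport g)
    (c ξ : mixedSpace K) :
    kernelTransform K (fun x => fderiv ℝ g x c) ξ = -(((archCharForm K ξ c : ℝ) : ℂ) * I) * kernelTransform K g ξ := by
  have hgd : Differentiable ℝ g := hg.differentiable (by simp)
  have hgc : Continuous g := hg.continuous
  have hg'c : Continuous fun x => fderiv ℝ g x c := (contDiff_fderiv_dir K hg c).continuous
  have hg's : HasCompactSupport fun x => fderiv ℝ g x c := hasCompactSupport_fderiv_dir K hgs c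
  have hec : Continuous (archChar K ξ) := continuous_archChar K ξ
  -- rewrite the derivative of the complexified kernel
  have hlhs : kernelTransform K (fun x => fderiv ℝ g x c) ξ =
      ∫ x, archChar K ξ x * fderiv ℝ (fun x => (g x : ℂ)) x c := by
    simp only [kernelTransform]
    refine integral_congr_ae (ae_of_all _ fun x => ?_)
    show ((fderiv ℝ g x c : ℝ) : ℂ) * archChar K ξ x = archChar K ξ x * fderiv ℝ (fun x => (g x : ℂ)) x c
    rw [fderiv_ofReal_comp_apply K hgd, mul_comm]
  rw [hlhs]
  -- integration by parts on the finite-dimensional real vector space `K_∞`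
  have h1 : Integrable fun x => fderiv ℝ (archChar K ξ) x c * (g x : ℂ) := by
    have : (fun x => fderiv ℝ (archChar K ξ) x c * (g x : ℂ)) =
        fun x => archChar K ξ x * ((archCharForm K ξ c : ℝ) * I) * (g x : ℂ) := by
      funext x; rw [fderiv_archChar_apply]
    rw [this]
    exact ((hec.mul continuous_const).mul (continuous_ofReal.comp hgc)).integrable_of_hasCompactSupport
      (hgs.comp_left ofReal_zero).mul_left
  have h2 : Integrable fun x => archChar K ξ x * fderiv ℝ (fun x => (g x : ℂ)) x c := by
    have : (fun x => archChar K ξ x * fderiv ℝ (fun x => (g x : ℂ)) x c) =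
        fun x => archChar K ξ x * ((fderiv ℝ g x c : ℝ) : ℂ) := by
      funext x; rw [fderiv_ofReal_comp_apply K hgd]
    rw [this]
    exact (hec.mul (continuous_ofReal.comp hg'c)).integrable_of_hasCompactSupport (hg's.comp_left ofReal_zero).mul_left
  have h3 : Integrable fun x => archChar K ξ x * (g x : ℂ) :=
    (hec.mul (continuous_ofReal.comp hgc)).integrable_of_hasCompactSupport (hgs.comp_left ofReal_zero).mul_left
  rw [integral_mul_fderiv_eq_neg_fderiv_mul_of_integrable h1 h2 h3 (fun x _ => differentiable_archChar K ξ x)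
    (fun x _ => (ofRealCLM.differentiableAt.comp x (hgd x)))]
  simp only [kernelTransform, fderiv_archChar_apply, neg_mul, ← integral_neg, ← integral_const_mul]
  congr 1
  funext x
  ring

/-! ### Place-pure directions and the bilinear form -/

variable {K}

/-- A place-pure direction at `w` has vanishing real components at the other real places. [folklore] -/
theorem IsPureDir.fst_eq_zero {w : InfinitePlace K} {c : mixedSpace K} (hc : IsPureDir K w c)
    (w' : {w' : InfinitePlace K // IsReal w'}) (hw' : (w' : InfinitePlace K) ≠ w) : c.1 w' = 0 := by
  have h := hc (Sum.inl w') hw'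
  rwa [stdBasis_apply_isReal] at h

/-- A place-pure direction at `w` has vanishing complex components at the other complex places. [folklore] -/
theorem IsPureDir.snd_eq_zero {w : InfinitePlace K} {c : mixedSpace K} (hc : IsPureDir K w c)
    (w' : {w' : InfinitePlace K // IsComplex w'}) (hw' : (w' : InfinitePlace K) ≠ w) : c.2 w' = 0 := by
  have h0 := hc (Sum.inr ⟨w', 0⟩) hw'
  have h1 := hc (Sum.inr ⟨w', 1⟩) hw'
  rw [stdBasis_apply_isComplex_fst] at h0
  rw [stdBasis_apply_isComplex_snd] at h1
  exact Complex.ext h0 h1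

omit [NumberField K] in
/-- The real component of `ξ` at a real place `w'` vanishes when `|ξ|_{w'} = 0`. [folklore] -/
theorem fst_eq_zero_of_normAtPlace_eq_zero {ξ : mixedSpace K} (w' : {w' : InfinitePlace K // IsReal w'})
    (h : normAtPlace (w' : InfinitePlace K) ξ = 0) : ξ.1 w' = 0 := by
  rw [normAtPlace_apply_of_isReal w'.2] at h
  exact norm_eq_zero.1 h

omit [NumberField K] in
/-- The complex component of `ξ` at a complex place `w'` vanishes when `|ξ|_{w'} = 0`. [folklore] -/
theorem snd_eq_zero_of_normAtPlace_eq_zero {ξ : mixedSpace K} (w' : {w' : InfinitePlace K // IsComplex w'})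
    (h : normAtPlace (w' : InfinitePlace K) ξ = 0) : ξ.2 w' = 0 := by
  rw [normAtPlace_apply_of_isComplex w'.2] at h
  exact norm_eq_zero.1 h

/-- The trace against a place-pure direction, termwise: every term of `Tr(ξ c)` with `c` pure at `w`
is bounded by `2 ‖c‖ |ξ|_w`, and vanishes if `|ξ|_w = 0`. Real places. [folklore] -/
theorem abs_fst_mul_le_of_isPureDir {w : InfinitePlace K} {c : mixedSpace K} (hc : IsPureDir K w c) (ξ : mixedSpace K)
    (w' : {w' : InfinitePlace K // IsReal w'}) : |ξ.1 w' * c.1 w'| ≤ normAtPlace w ξ * ‖c‖ := by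
  by_cases hw' : (w' : InfinitePlace K) = w
  · subst hw'
    rw [abs_mul, normAtPlace_apply_of_isReal w'.2, Real.norm_eq_abs]
    refine mul_le_mul_of_nonneg_left ?_ (abs_nonneg _)
    calc |c.1 w'| = ‖c.1 w'‖ := (Real.norm_eq_abs _).symm
      _ ≤ ‖c.1‖ := norm_le_pi_norm _ _
      _ ≤ ‖c‖ := le_max_left _ _
  · rw [hc.fst_eq_zero w' hw', mul_zero, abs_zero]
    exact mul_nonneg (normAtPlace_nonneg _ _) (norm_nonneg _)

/-- Complex places: `|2 Re(ξ_{w'} c_{w'})| ≤ 2 |ξ|_w ‖c‖` for `c` pure at `w`. [folklore] -/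
theorem abs_two_mul_re_snd_mul_le_of_isPureDir {w : InfinitePlace K} {c : mixedSpace K} (hc : IsPureDir K w c)
    (ξ : mixedSpace K) (w' : {w' : InfinitePlace K // IsComplex w'}) :
    |2 * (ξ.2 w' * c.2 w').re| ≤ 2 * (normAtPlace w ξ * ‖c‖) := by
  rw [abs_mul, abs_two]
  refine mul_le_mul_of_nonneg_left ?_ zero_le_two
  by_cases hw' : (w' : InfinitePlace K) = w
  · subst hw'
    rw [normAtPlace_apply_of_isComplex w'.2]
    calc |(ξ.2 w' * c.2 w').re| ≤ ‖ξ.2 w' * c.2 w'‖ := Complex.abs_re_le_norm _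
      _ = ‖ξ.2 w'‖ * ‖c.2 w'‖ := norm_mul _ _
      _ ≤ ‖ξ.2 w'‖ * ‖c‖ := by
        refine mul_le_mul_of_nonneg_left ?_ (norm_nonneg _)
        exact (norm_le_pi_norm _ _).trans (le_max_right _ _)
  · rw [hc.snd_eq_zero w' hw', mul_zero, Complex.zero_re, abs_zero]
    exact mul_nonneg (normAtPlace_nonneg _ _) (norm_nonneg _)

/-- **`B(ξ, c)` only sees `ξ_w` for `c` pure at `w`**: `|B(ξ, c)| ≤ C_K ‖c‖ |ξ|_w` with
`C_K = 4π (r₁ + r₂)`. [folklore] -/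
theorem abs_archCharForm_le_of_isPureDir {w : InfinitePlace K} {c : mixedSpace K} (hc : IsPureDir K w c) (ξ : mixedSpace K) :
    |archCharForm K ξ c| ≤ (4 * π * (Fintype.card {w' : InfinitePlace K // IsReal w'} + Fintype.card {w' : InfinitePlace K // IsComplex w'})) *
      ‖c‖ * normAtPlace w ξ := by
  rw [archCharForm_apply, mixedTrace_apply, abs_mul, abs_neg, abs_of_pos (by positivity : (0 : ℝ) < 2 * π)]
  have h1 : |∑ w', (ξ * c).1 w'| ≤ ∑ w' : {w' : InfinitePlace K // IsReal w'}, normAtPlace w ξ * ‖c‖ := by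
    refine (Finset.abs_sum_le_sum_abs _ _).trans (Finset.sum_le_sum fun w' _ => ?_)
    exact abs_fst_mul_le_of_isPureDir hc ξ w'
  have h2 : |∑ w', 2 * ((ξ * c).2 w').re| ≤ ∑ w' : {w' : InfinitePlace K // IsComplex w'}, 2 * (normAtPlace w ξ * ‖c‖) := by
    refine (Finset.abs_sum_le_sum_abs _ _).trans (Finset.sum_le_sum fun w' _ => ?_)
    exact abs_two_mul_re_snd_mul_le_of_isPureDir hc ξ w'
  simp only [Finset.sum_const, nsmul_eq_mul, Finset.card_univ] at h1 h2
  have h0 : 0 ≤ normAtPlace w ξ * ‖c‖ := mul_nonneg (normAtPlace_nonneg _ _) (norm_nonneg _)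
  calc 2 * π * |(∑ w', (ξ * c).1 w') + ∑ w', 2 * ((ξ * c).2 w').re|
      ≤ 2 * π * ((Fintype.card {w' : InfinitePlace K // IsReal w'} : ℝ) * (normAtPlace w ξ * ‖c‖) +
          (Fintype.card {w' : InfinitePlace K // IsComplex w'} : ℝ) * (2 * (normAtPlace w ξ * ‖c‖))) := by
        refine mul_le_mul_of_nonneg_left ((abs_add_le _ _).trans (add_le_add h1 h2)) (by positivity)
    _ ≤ (4 * π * (Fintype.card {w' : InfinitePlace K // IsReal w'} + Fintype.card {w' : InfinitePlace K // IsComplex w'})) *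
          ‖c‖ * normAtPlace w ξ := by
        have hr₁ : (0 : ℝ) ≤ Fintype.card {w' : InfinitePlace K // IsReal w'} := Nat.cast_nonneg _
        have hX := mul_nonneg (mul_nonneg (by positivity : (0 : ℝ) ≤ 2 * π) hr₁) h0
        nlinarith [hX]

/-- **`B(ξ, c) = 0` when `c` is pure at `w` and `ξ_w = 0`.** [folklore] -/
theorem archCharForm_eq_zero_of_isPureDir {w : InfinitePlace K} {c : mixedSpace K} (hc : IsPureDir K w c) {ξ : mixedSpace K}
    (hξ : normAtPlace w ξ = 0) : archCharForm K ξ c = 0 := by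
  have h := abs_archCharForm_le_of_isPureDir hc ξ
  rw [hξ, mul_zero] at h
  exact abs_eq_zero.1 (le_antisymm h (abs_nonneg _))

/-! ### Vanishing of the transform along the coordinate hyperplanes -/

namespace IsMomentKernel

/-- **Vanishing**: the transform of a moment kernel with `k w ≥ 1` vanishes on `{ξ_w = 0}`.
[cite: JacquetShalikaAJM1981, §4] -/
theorem kernelTransform_eq_zero {k : InfinitePlace K → ℕ} {g : mixedSpace K → ℝ} (hg : IsMomentKernel K k g) :
    ∀ {ξ : mixedSpace K} {w : InfinitePlace K}, 1 ≤ k w → normAtPlace w ξ = 0 → kernelTransform K g ξ = 0 := by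
  induction hg with
  | base _ _ => intro ξ w hk _; simp at hk
  | @deriv k g w' c hc hg ih =>
    intro ξ w hk hξ
    rw [kernelTransform_fderiv K hg.contDiff hg.hasCompactSupport]
    by_cases hw : w = w'
    · subst hw
      rw [archCharForm_eq_zero_of_isPureDir hc hξ, ofReal_zero, zero_mul, neg_zero, zero_mul]
    · have hk' : 1 ≤ k w := by simpa [Pi.add_apply, Pi.single_eq_of_ne hw] using hk
      rw [ih hk' hξ, mul_zero]
  | zero k => intro ξ w _ _; simp
  | add hg hg' ih ih' =>
    intro ξ w hk hξ
    rw [kernelTransform_add K hg.continuous hg.hasCompactSupport hg'.continuous hg'.hasCompactSupport, ih hk hξ, ih' hk hξ,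
      add_zero]
  | smul a _ ih => intro ξ w hk hξ; rw [kernelTransform_smul, ih hk hξ, mul_zero]
  | mono hk _ ih => intro ξ w hk' hξ; exact ih (hk'.trans (hk w)) hξ

/-- A non-unit of `K_∞` has a vanishing place norm. [folklore] -/
theorem exists_normAtPlace_eq_zero_of_not_isUnit {ξ : mixedSpace K} (hξ : ¬IsUnit ξ) : ∃ w, normAtPlace w ξ = 0 := by
  by_contra h
  push Not at h
  apply hξ
  refine Prod.isUnit_iff.2 ⟨Pi.isUnit_iff.2 fun w => ?_, Pi.isUnit_iff.2 fun w => ?_⟩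
  · have hw := h w.1
    rw [normAtPlace_apply_of_isReal w.2, norm_ne_zero_iff] at hw
    exact isUnit_iff_ne_zero.2 hw
  · have hw := h w.1
    rw [normAtPlace_apply_of_isComplex w.2, norm_ne_zero_iff] at hw
    exact isUnit_iff_ne_zero.2 hw

/-- **The transform of a moment kernel with `k ≥ 1` vanishes at every non-unit of `K_∞`** (the
hypothesis `hg0` of `lintegral_weight_mul_norm_sq_kirillovKernel_le`). [cite: JacquetShalikaAJM1981, §4] -/
theorem kernelTransform_eq_zero_of_not_isUnit {k : InfinitePlace K → ℕ} {g : mixedSpace K → ℝ} (hg : IsMomentKernel K k g)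
    (hk : ∀ w, 1 ≤ k w) {ξ : mixedSpace K} (hξ : ¬IsUnit ξ) : kernelTransform K g ξ = 0 := by
  obtain ⟨w, hw⟩ := exists_normAtPlace_eq_zero_of_not_isUnit hξ
  exact hg.kernelTransform_eq_zero (hk w) hw

end IsMomentKernel

/-! ### Schwartz decay of `ĥ` for `h ∈ C_c^∞(K_∞)` -/

/-- Iterated directional derivative along a fixed direction. [folklore] -/
def iterDirDeriv (e : mixedSpace K) : ℕ → (mixedSpace K → ℝ) → (mixedSpace K → ℝ)
  | 0, h => h
  | q + 1, h => fun x => fderiv ℝ (iterDirDeriv e q h) x e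

/-- Iterated directional derivatives of `C^∞` functions are `C^∞`. [folklore] -/
theorem contDiff_iterDirDeriv (e : mixedSpace K) {h : mixedSpace K → ℝ} (hs : ContDiff ℝ ∞ h) :
    ∀ q, ContDiff ℝ ∞ (iterDirDeriv e q h)
  | 0 => hs
  | q + 1 => contDiff_fderiv_dir K (contDiff_iterDirDeriv e hs q) e

omit [NumberField K] in
/-- Iterated directional derivatives of compactly supported functions are compactly supported. [folklore] -/
theorem hasCompactSupport_iterDirDeriv (e : mixedSpace K) {h : mixedSpace K → ℝ} (hc : HasCompactSupport h) :
    ∀ q, HasCompactSupport (iterDirDeriv e q h)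
  | 0 => hc
  | q + 1 => hasCompactSupport_fderiv_dir K (hasCompactSupport_iterDirDeriv e hc q) e

/-- **Iterated integration by parts along one direction**: `(∂_e^q h)^(ξ) = (-iB(ξ,e))^q ĥ(ξ)`. [folklore] -/
theorem kernelTransform_iterDirDeriv (e : mixedSpace K) {h : mixedSpace K → ℝ} (hs : ContDiff ℝ ∞ h) (hc : HasCompactSupport h)
    (ξ : mixedSpace K) :
    ∀ q, kernelTransform K (iterDirDeriv e q h) ξ = (-(((archCharForm K ξ e : ℝ) : ℂ) * I)) ^ q * kernelTransform K h ξ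
  | 0 => by simp [iterDirDeriv]
  | q + 1 => by
    have h1 : iterDirDeriv e (q + 1) h = fun x => fderiv ℝ (iterDirDeriv e q h) x e := rfl
    rw [h1, kernelTransform_fderiv K (contDiff_iterDirDeriv e hs q) (hasCompactSupport_iterDirDeriv e hc q),
      kernelTransform_iterDirDeriv e hs hc ξ q, pow_succ]
    ring

/-- `|B(ξ, e)|^q ‖ĥ(ξ)‖ ≤ ∫ |∂_e^q h|`. [folklore] -/
theorem pow_abs_archCharForm_mul_norm_kernelTransform_le (e : mixedSpace K) {h : mixedSpace K → ℝ} (hs : ContDiff ℝ ∞ h)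
    (hc : HasCompactSupport h) (ξ : mixedSpace K) (q : ℕ) :
    |archCharForm K ξ e| ^ q * ‖kernelTransform K h ξ‖ ≤ ∫ x, |iterDirDeriv e q h x| := by
  have h1 := norm_kernelTransform_le K (iterDirDeriv e q h) ξ
  rw [kernelTransform_iterDirDeriv e hs hc ξ q, norm_mul, norm_pow, norm_neg, norm_mul, Complex.norm_I, mul_one,
    Complex.norm_real, Real.norm_eq_abs] at h1
  exact h1

/-- The coordinate directions of `K_∞` used to dominate the sup norm by traces
(`norm_le_sum_abs_mixedTrace_mul`). [folklore] -/
def coordDirs (K : Type) [Field K] [NumberField K] : Finset (mixedSpace K) :=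
  (Finset.univ.image fun w : {w : InfinitePlace K // IsReal w} => ((Pi.single w 1, 0) : mixedSpace K)) ∪
    ((Finset.univ.image fun w : {w : InfinitePlace K // IsComplex w} => ((0, Pi.single w 1) : mixedSpace K)) ∪
      (Finset.univ.image fun w : {w : InfinitePlace K // IsComplex w} => ((0, Pi.single w Complex.I) : mixedSpace K)))

/-- **The sup norm is dominated by the character form against the coordinate directions**:
`‖ξ‖ ≤ 3 (2π)⁻¹ ∑_{e ∈ coordDirs} |B(ξ, e)|`. [folklore] -/
theorem norm_le_sum_abs_archCharForm (ξ : mixedSpace K) :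
    ‖ξ‖ ≤ 3 * (2 * π)⁻¹ * ∑ e ∈ coordDirs K, |archCharForm K ξ e| := by
  have hB : ∀ e, |archCharForm K ξ e| = 2 * π * |mixedTrace K (ξ * e)| := fun e => by
    rw [archCharForm_apply, abs_mul, abs_neg, abs_of_pos (by positivity : (0 : ℝ) < 2 * π)]
  have h := norm_le_sum_abs_mixedTrace_mul K ξ
  -- each of the three sums is dominated by the sum over `coordDirs`
  have hsub : ∀ e ∈ coordDirs K, 0 ≤ |mixedTrace K (ξ * e)| := fun e _ => abs_nonneg _
  have h1 : ∑ w : {w : InfinitePlace K // IsReal w}, |mixedTrace K (ξ * ((Pi.single w 1, 0) : mixedSpace K))| ≤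
      ∑ e ∈ coordDirs K, |mixedTrace K (ξ * e)| := by
    rw [← Finset.sum_image (f := fun e => |mixedTrace K (ξ * e)|)
      (g := fun w : {w : InfinitePlace K // IsReal w} => ((Pi.single w 1, 0) : mixedSpace K))]
    · exact Finset.sum_le_sum_of_subset_of_nonneg Finset.subset_union_left fun e he _ => abs_nonneg _
    · intro w _ w' _ hww'
      have := congrArg (fun x : mixedSpace K => x.1 w) hww'
      by_contra hne
      simp [Ne.symm hne] at this
  have h2 : ∑ w : {w : InfinitePlace K // IsComplex w}, |mixedTrace K (ξ * ((0, Pi.single w 1) : mixedSpace K))| ≤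
      ∑ e ∈ coordDirs K, |mixedTrace K (ξ * e)| := by
    rw [← Finset.sum_image (f := fun e => |mixedTrace K (ξ * e)|)
      (g := fun w : {w : InfinitePlace K // IsComplex w} => ((0, Pi.single w 1) : mixedSpace K))]
    · exact Finset.sum_le_sum_of_subset_of_nonneg (Finset.subset_union_left.trans Finset.subset_union_right)
        fun e he _ => abs_nonneg _
    · intro w _ w' _ hww'
      have := congrArg (fun x : mixedSpace K => x.2 w) hww'
      by_contra hne
      simp [Ne.symm hne] at this
  have h3 : ∑ w : {w : InfinitePlace K // IsComplex w}, |mixedTrace K (ξ * ((0, Pi.single w Complex.I) : mixedSpace K))| ≤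
      ∑ e ∈ coordDirs K, |mixedTrace K (ξ * e)| := by
    rw [← Finset.sum_image (f := fun e => |mixedTrace K (ξ * e)|)
      (g := fun w : {w : InfinitePlace K // IsComplex w} => ((0, Pi.single w Complex.I) : mixedSpace K))]
    · exact Finset.sum_le_sum_of_subset_of_nonneg (Finset.subset_union_right.trans Finset.subset_union_right)
        fun e he _ => abs_nonneg _
    · intro w _ w' _ hww'
      have := congrArg (fun x : mixedSpace K => x.2 w) hww'
      by_contra hne
      simp [Ne.symm hne, Complex.I_ne_zero] at this
  have hsum : ∑ e ∈ coordDirs K, |archCharForm K ξ e| = 2 * π * ∑ e ∈ coordDirs K, |mixedTrace K (ξ * e)| := by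
    rw [Finset.mul_sum]
    exact Finset.sum_congr rfl fun e _ => hB e
  rw [hsum, show 3 * (2 * π)⁻¹ * (2 * π * ∑ e ∈ coordDirs K, |mixedTrace K (ξ * e)|) =
    3 * ∑ e ∈ coordDirs K, |mixedTrace K (ξ * e)| by field_simp]
  calc ‖ξ‖ ≤ _ := h
    _ ≤ ∑ e ∈ coordDirs K, |mixedTrace K (ξ * e)| + (∑ e ∈ coordDirs K, |mixedTrace K (ξ * e)| +
          ∑ e ∈ coordDirs K, |mixedTrace K (ξ * e)|) := by
        rw [Finset.sum_add_distrib]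
        exact add_le_add h1 (add_le_add h2 h3)
    _ = 3 * ∑ e ∈ coordDirs K, |mixedTrace K (ξ * e)| := by ring


/-- `(1 + t)^q ≤ 2^q (1 + t^q)` for `t ≥ 0` (a private copy of the lemma of the same name in
`ArchimedeanDetIntegral`, to keep the import closure small). [folklore] -/
private theorem one_add_pow_le_two_pow_mul_one_add {t : ℝ} (ht : 0 ≤ t) (q : ℕ) : (1 + t) ^ q ≤ 2 ^ q * (1 + t ^ q) := by
  rcases le_total t 1 with h | h
  · calc (1 + t) ^ q ≤ 2 ^ q := pow_le_pow_left₀ (by positivity) (by linarith) q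
      _ ≤ 2 ^ q * (1 + t ^ q) := le_mul_of_one_le_right (by positivity) (by nlinarith [pow_nonneg ht q])
  · calc (1 + t) ^ q ≤ (2 * t) ^ q := pow_le_pow_left₀ (by positivity) (by linarith) q
      _ = 2 ^ q * t ^ q := mul_pow _ _ _
      _ ≤ 2 ^ q * (1 + t ^ q) := by nlinarith [pow_nonneg ht q, pow_nonneg (zero_le_two (α := ℝ)) q]

/-- **Schwartz decay of the transform of a `C_c^∞` kernel**: for every `q` there is `C` with
`(1 + ‖ξ‖)^q ‖ĥ(ξ)‖ ≤ C` (integration by parts `q` times along each coordinate direction).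
[cite: Folland1995, Thm. 4.3] -/
theorem exists_one_add_norm_pow_mul_norm_kernelTransform_le {h : mixedSpace K → ℝ} (hs : ContDiff ℝ ∞ h)
    (hc : HasCompactSupport h) (q : ℕ) :
    ∃ C : ℝ, 0 ≤ C ∧ ∀ ξ : mixedSpace K, (1 + ‖ξ‖) ^ q * ‖kernelTransform K h ξ‖ ≤ C := by
  -- the constants
  set A : ℝ := 3 * (2 * π)⁻¹ with hA
  have hA0 : 0 ≤ A := by positivity
  set N : ℕ := (coordDirs K).card with hN
  set D : ℝ := ∑ e ∈ coordDirs K, ∫ x, |iterDirDeriv e q h x| with hD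
  have hD0 : 0 ≤ D := Finset.sum_nonneg fun e _ => integral_nonneg fun x => abs_nonneg _
  set I₀ : ℝ := ∫ x, |h x| with hI₀
  have hI₀0 : 0 ≤ I₀ := integral_nonneg fun x => abs_nonneg _
  have hI₀le : ∀ ξ, ‖kernelTransform K h ξ‖ ≤ I₀ := fun ξ => norm_kernelTransform_le K h ξ
  have hDle : ∀ ξ (m : ℕ), (∑ e ∈ coordDirs K, |archCharForm K ξ e| ^ m) * ‖kernelTransform K h ξ‖ ≤
      ∑ e ∈ coordDirs K, ∫ x, |iterDirDeriv e m h x| := fun ξ m => by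
    rw [Finset.sum_mul]
    exact Finset.sum_le_sum fun e _ => pow_abs_archCharForm_mul_norm_kernelTransform_le e hs hc ξ m
  clear_value A N I₀
  rcases Nat.eq_zero_or_pos q with rfl | hq
  · refine ⟨I₀, hI₀0, fun ξ => ?_⟩
    rw [pow_zero, one_mul]
    exact hI₀le ξ
  obtain ⟨n, rfl⟩ : ∃ n, q = n + 1 := ⟨q - 1, by omega⟩
  have hDle' : ∀ ξ, (∑ e ∈ coordDirs K, |archCharForm K ξ e| ^ (n + 1)) * ‖kernelTransform K h ξ‖ ≤ D := fun ξ => by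
    rw [hD]; exact hDle ξ (n + 1)
  clear_value D
  refine ⟨2 ^ (n + 1) * (I₀ + A ^ (n + 1) * ((N : ℝ) ^ n * D)),
    mul_nonneg (pow_nonneg zero_le_two _) (add_nonneg hI₀0 (mul_nonneg (pow_nonneg hA0 _)
      (mul_nonneg (pow_nonneg (Nat.cast_nonneg _) _) hD0))), fun ξ => ?_⟩
  have hT0 : 0 ≤ ‖kernelTransform K h ξ‖ := norm_nonneg _
  -- `‖ξ‖^q ‖ĥ‖ ≤ A^q N^{q-1} D`
  have hS : ‖ξ‖ ^ (n + 1) * ‖kernelTransform K h ξ‖ ≤ A ^ (n + 1) * ((N : ℝ) ^ n * D) := by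
    have h1 : ‖ξ‖ ^ (n + 1) ≤ A ^ (n + 1) * (∑ e ∈ coordDirs K, |archCharForm K ξ e|) ^ (n + 1) := by
      rw [← mul_pow]
      refine pow_le_pow_left₀ (norm_nonneg _) ?_ _
      rw [hA]
      exact norm_le_sum_abs_archCharForm ξ
    have h2 : (∑ e ∈ coordDirs K, |archCharForm K ξ e|) ^ (n + 1) ≤
        (N : ℝ) ^ n * ∑ e ∈ coordDirs K, |archCharForm K ξ e| ^ (n + 1) := by
      rw [hN]
      exact pow_sum_le_card_mul_sum_pow (s := coordDirs K) (f := fun e => |archCharForm K ξ e|) (fun e _ => abs_nonneg _) n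
    have h3 : (∑ e ∈ coordDirs K, |archCharForm K ξ e| ^ (n + 1)) * ‖kernelTransform K h ξ‖ ≤ D := hDle' ξ
    calc ‖ξ‖ ^ (n + 1) * ‖kernelTransform K h ξ‖
        ≤ A ^ (n + 1) * ((N : ℝ) ^ n * ∑ e ∈ coordDirs K, |archCharForm K ξ e| ^ (n + 1)) * ‖kernelTransform K h ξ‖ :=
          mul_le_mul_of_nonneg_right (h1.trans (mul_le_mul_of_nonneg_left h2 (pow_nonneg hA0 _))) hT0
      _ = A ^ (n + 1) * ((N : ℝ) ^ n * ((∑ e ∈ coordDirs K, |archCharForm K ξ e| ^ (n + 1)) * ‖kernelTransform K h ξ‖)) := by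
          ring
      _ ≤ A ^ (n + 1) * ((N : ℝ) ^ n * D) :=
          mul_le_mul_of_nonneg_left (mul_le_mul_of_nonneg_left h3 (pow_nonneg (Nat.cast_nonneg _) _)) (pow_nonneg hA0 _)
  calc (1 + ‖ξ‖) ^ (n + 1) * ‖kernelTransform K h ξ‖
      ≤ 2 ^ (n + 1) * (1 + ‖ξ‖ ^ (n + 1)) * ‖kernelTransform K h ξ‖ :=
        mul_le_mul_of_nonneg_right (one_add_pow_le_two_pow_mul_one_add (norm_nonneg ξ) _) hT0
    _ = 2 ^ (n + 1) * (‖kernelTransform K h ξ‖ + ‖ξ‖ ^ (n + 1) * ‖kernelTransform K h ξ‖) := by ring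
    _ ≤ 2 ^ (n + 1) * (I₀ + A ^ (n + 1) * ((N : ℝ) ^ n * D)) :=
        mul_le_mul_of_nonneg_left (add_le_add (hI₀le ξ) hS) (pow_nonneg zero_le_two _)

/-! ### Place-wise decay of moment kernels -/

variable (K) in
/-- **Place-wise decay at order `k`**: for every `p`,
`‖ĝ(ξ)‖ ∏_w max(1, |ξ_w|)^p ≤ C ∏_w min(1, |ξ_w|)^{k w}`. [cite: JacquetShalikaAJM1981, §4] -/
def HasPlaceDecay (k : InfinitePlace K → ℕ) (g : mixedSpace K → ℝ) : Prop :=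
  ∀ p : ℕ, ∃ C : ℝ, 0 ≤ C ∧ ∀ ξ : mixedSpace K,
    ‖kernelTransform K g ξ‖ * ∏ w, max 1 (normAtPlace w ξ) ^ p ≤ C * ∏ w, min 1 (normAtPlace w ξ) ^ k w

/-- `max(1, |ξ_w|) ≤ 1 + ‖ξ‖`. [folklore] -/
theorem max_one_normAtPlace_le (w : InfinitePlace K) (ξ : mixedSpace K) : max 1 (normAtPlace w ξ) ≤ 1 + ‖ξ‖ :=
  max_le (le_add_of_nonneg_right (norm_nonneg _)) ((normAtPlace_le_norm K w ξ).trans (le_add_of_nonneg_left zero_le_one))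

/-- `∏_w max(1, |ξ_w|)^p ≤ (1 + ‖ξ‖)^{p r}`, `r` the number of infinite places. [folklore] -/
theorem prod_max_one_normAtPlace_pow_le (ξ : mixedSpace K) (p : ℕ) :
    ∏ w, max 1 (normAtPlace w ξ) ^ p ≤ (1 + ‖ξ‖) ^ (p * Fintype.card (InfinitePlace K)) := by
  calc ∏ w, max 1 (normAtPlace w ξ) ^ p ≤ ∏ _w : InfinitePlace K, (1 + ‖ξ‖) ^ p :=
        Finset.prod_le_prod (fun w _ => by positivity) fun w _ =>
          pow_le_pow_left₀ (by positivity) (max_one_normAtPlace_le w ξ) p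
    _ = (1 + ‖ξ‖) ^ (p * Fintype.card (InfinitePlace K)) := by
        rw [Finset.prod_const, Finset.card_univ, ← pow_mul]

/-- **Base case**: a `C_c^∞` kernel has place-wise decay at order `0`. [folklore] -/
theorem hasPlaceDecay_zero {h : mixedSpace K → ℝ} (hs : ContDiff ℝ ∞ h) (hc : HasCompactSupport h) : HasPlaceDecay K 0 h := by
  intro p
  obtain ⟨C, hC0, hC⟩ := exists_one_add_norm_pow_mul_norm_kernelTransform_le hs hc (p * Fintype.card (InfinitePlace K))
  refine ⟨C, hC0, fun ξ => ?_⟩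
  simp only [Pi.zero_apply, pow_zero, Finset.prod_const_one, mul_one]
  calc ‖kernelTransform K h ξ‖ * ∏ w, max 1 (normAtPlace w ξ) ^ p
      ≤ ‖kernelTransform K h ξ‖ * (1 + ‖ξ‖) ^ (p * Fintype.card (InfinitePlace K)) :=
        mul_le_mul_of_nonneg_left (prod_max_one_normAtPlace_pow_le ξ p) (norm_nonneg _)
    _ ≤ C := by rw [mul_comm]; exact hC ξ

/-- One `max` factor against the product: `max(1,|ξ_w|) ∏_v max(1,|ξ_v|)^p ≤ ∏_v max(1,|ξ_v|)^{p+1}`. [folklore] -/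
theorem max_mul_prod_max_pow_le (ξ : mixedSpace K) (w : InfinitePlace K) (p : ℕ) :
    max 1 (normAtPlace w ξ) * ∏ v, max 1 (normAtPlace v ξ) ^ p ≤ ∏ v, max 1 (normAtPlace v ξ) ^ (p + 1) := by
  have h1 : max 1 (normAtPlace w ξ) ≤ ∏ v, max 1 (normAtPlace v ξ) := by
    rw [← Finset.mul_prod_erase Finset.univ (fun v => max 1 (normAtPlace v ξ)) (Finset.mem_univ w)]
    refine le_mul_of_one_le_right (by positivity) ?_
    calc (1 : ℝ) = ∏ _v ∈ Finset.univ.erase w, (1 : ℝ) := Finset.prod_const_one.symm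
      _ ≤ ∏ v ∈ Finset.univ.erase w, max 1 (normAtPlace v ξ) :=
          Finset.prod_le_prod (fun v _ => zero_le_one) fun v _ => le_max_left _ _
  calc max 1 (normAtPlace w ξ) * ∏ v, max 1 (normAtPlace v ξ) ^ p
      ≤ (∏ v, max 1 (normAtPlace v ξ)) * ∏ v, max 1 (normAtPlace v ξ) ^ p :=
        mul_le_mul_of_nonneg_right h1 (Finset.prod_nonneg fun v _ => by positivity)
    _ = ∏ v, max 1 (normAtPlace v ξ) ^ (p + 1) := by
        rw [← Finset.prod_mul_distrib]
        exact Finset.prod_congr rfl fun v _ => by ring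

/-- One `min` factor into the product: `min(1,|ξ_w|) ∏_v min(1,|ξ_v|)^{k v} = ∏_v min(1,|ξ_v|)^{(k + δ_w) v}`. [folklore] -/
theorem min_mul_prod_min_pow_eq (ξ : mixedSpace K) (w : InfinitePlace K) (k : InfinitePlace K → ℕ) :
    min 1 (normAtPlace w ξ) * ∏ v, min 1 (normAtPlace v ξ) ^ k v =
      ∏ v, min 1 (normAtPlace v ξ) ^ (k + Pi.single w 1 : InfinitePlace K → ℕ) v := by
  have hsplit : ∏ v, min 1 (normAtPlace v ξ) ^ (k + Pi.single w 1 : InfinitePlace K → ℕ) v =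
      (∏ v, min 1 (normAtPlace v ξ) ^ k v) * ∏ v, min 1 (normAtPlace v ξ) ^ (Pi.single w 1 : InfinitePlace K → ℕ) v := by
    rw [← Finset.prod_mul_distrib]
    exact Finset.prod_congr rfl fun v _ => by rw [Pi.add_apply, pow_add]
  have h2 : ∏ v, min 1 (normAtPlace v ξ) ^ (Pi.single w 1 : InfinitePlace K → ℕ) v = min 1 (normAtPlace w ξ) := by
    rw [Finset.prod_eq_single w]
    · rw [Pi.single_eq_same, pow_one]
    · intro v _ hv; rw [Pi.single_eq_of_ne hv, pow_zero]
    · intro hw; exact absurd (Finset.mem_univ w) hw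
  rw [hsplit, h2, mul_comm]

namespace IsMomentKernel

/-- **Place-wise decay of moment kernels**: each place-pure derivative at `w` buys one factor
`min(1, |ξ_w|)` (at the expense of one `max(1, |ξ_w|)`, absorbed by the arbitrary `p`).
[cite: JacquetShalikaAJM1981, §4] -/
theorem hasPlaceDecay {k : InfinitePlace K → ℕ} {g : mixedSpace K → ℝ} (hg : IsMomentKernel K k g) : HasPlaceDecay K k g := by
  induction hg with
  | base hs hc => exact hasPlaceDecay_zero hs hc
  | @deriv k g w c hc hg ih =>
    intro p
    obtain ⟨C, hC0, hC⟩ := ih (p + 1)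
    set Cc : ℝ := (4 * π * (Fintype.card {w' : InfinitePlace K // IsReal w'} + Fintype.card {w' : InfinitePlace K // IsComplex w'})) *
      ‖c‖ with hCc
    have hCc0 : 0 ≤ Cc := by positivity
    refine ⟨Cc * C, mul_nonneg hCc0 hC0, fun ξ => ?_⟩
    have hmm : normAtPlace w ξ = min 1 (normAtPlace w ξ) * max 1 (normAtPlace w ξ) := by rw [min_mul_max, one_mul]
    rw [kernelTransform_fderiv K hg.contDiff hg.hasCompactSupport, norm_mul, norm_neg, norm_mul, Complex.norm_I, mul_one,
      Complex.norm_real, Real.norm_eq_abs]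
    have hP0 : 0 ≤ ∏ v, max 1 (normAtPlace v ξ) ^ p := Finset.prod_nonneg fun v _ => by positivity
    have hmin0 : 0 ≤ min 1 (normAtPlace w ξ) := le_min zero_le_one (normAtPlace_nonneg _ _)
    calc |archCharForm K ξ c| * ‖kernelTransform K g ξ‖ * ∏ v, max 1 (normAtPlace v ξ) ^ p
        ≤ Cc * normAtPlace w ξ * ‖kernelTransform K g ξ‖ * ∏ v, max 1 (normAtPlace v ξ) ^ p := by
          gcongr
          exact abs_archCharForm_le_of_isPureDir hc ξ
      _ = Cc * min 1 (normAtPlace w ξ) *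
            (‖kernelTransform K g ξ‖ * (max 1 (normAtPlace w ξ) * ∏ v, max 1 (normAtPlace v ξ) ^ p)) := by
          conv_lhs => rw [hmm]
          ring
      _ ≤ Cc * min 1 (normAtPlace w ξ) * (‖kernelTransform K g ξ‖ * ∏ v, max 1 (normAtPlace v ξ) ^ (p + 1)) := by
          gcongr
          exact max_mul_prod_max_pow_le ξ w p
      _ ≤ Cc * min 1 (normAtPlace w ξ) * (C * ∏ v, min 1 (normAtPlace v ξ) ^ k v) :=
          mul_le_mul_of_nonneg_left (hC ξ) (mul_nonneg hCc0 hmin0)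
      _ = Cc * C * ∏ v, min 1 (normAtPlace v ξ) ^ (k + Pi.single w 1 : InfinitePlace K → ℕ) v := by
          rw [← min_mul_prod_min_pow_eq]
          ring
  | zero k => exact fun p => ⟨0, le_rfl, fun ξ => by simp⟩
  | add hg hg' ih ih' =>
    intro p
    obtain ⟨C, hC0, hC⟩ := ih p
    obtain ⟨C', hC'0, hC'⟩ := ih' p
    refine ⟨C + C', add_nonneg hC0 hC'0, fun ξ => ?_⟩
    rw [kernelTransform_add K hg.continuous hg.hasCompactSupport hg'.continuous hg'.hasCompactSupport, add_mul]
    calc ‖kernelTransform K _ ξ + kernelTransform K _ ξ‖ * ∏ w, max 1 (normAtPlace w ξ) ^ p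
        ≤ (‖kernelTransform K _ ξ‖ + ‖kernelTransform K _ ξ‖) * ∏ w, max 1 (normAtPlace w ξ) ^ p :=
          mul_le_mul_of_nonneg_right (norm_add_le _ _) (Finset.prod_nonneg fun v _ => by positivity)
      _ ≤ C * ∏ w, min 1 (normAtPlace w ξ) ^ _ + C' * ∏ w, min 1 (normAtPlace w ξ) ^ _ := by
          rw [add_mul]; exact add_le_add (hC ξ) (hC' ξ)
  | smul a _ ih =>
    intro p
    obtain ⟨C, hC0, hC⟩ := ih p
    refine ⟨|a| * C, mul_nonneg (abs_nonneg a) hC0, fun ξ => ?_⟩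
    rw [kernelTransform_smul, norm_mul, Complex.norm_real, Real.norm_eq_abs, mul_assoc, mul_assoc]
    exact mul_le_mul_of_nonneg_left (hC ξ) (abs_nonneg a)
  | @mono k k' g hk _ ih =>
    intro p
    obtain ⟨C, hC0, hC⟩ := ih p
    refine ⟨C, hC0, fun ξ => (hC ξ).trans (mul_le_mul_of_nonneg_left ?_ hC0)⟩
    refine Finset.prod_le_prod (fun w _ => pow_nonneg (le_min zero_le_one (normAtPlace_nonneg _ _)) _) fun w _ => ?_
    exact pow_le_pow_of_le_one (le_min zero_le_one (normAtPlace_nonneg _ _)) (min_le_left _ _) (hk w)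

end IsMomentKernel


/-! ### Continuity of the transform -/

/-- The transform of a continuous compactly supported kernel is continuous. [folklore] -/
theorem continuous_kernelTransform {g : mixedSpace K → ℝ} (hg : Continuous g) (hgs : HasCompactSupport g) :
    Continuous (kernelTransform K g) := by
  have hk : Continuous (Function.uncurry fun (ξ : mixedSpace K) (x : mixedSpace K) => (g x : ℂ) * archChar K ξ x) := by
    refine ((continuous_ofReal.comp hg).comp continuous_snd).mul ?_
    show Continuous fun p : mixedSpace K × mixedSpace K => cexp ((archCharForm K p.1 p.2 : ℝ) * I)
    refine continuous_exp.comp ((continuous_ofReal.comp ?_).mul continuous_const)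
    have hB : Continuous fun p : mixedSpace K × mixedSpace K => mixedTrace K (p.1 * p.2) :=
      (mixedTrace K).continuous_of_finiteDimensional.comp (continuous_fst.mul continuous_snd)
    simp only [archCharForm_apply]
    exact continuous_const.mul hB
  have hcont := continuous_parametric_integral_of_continuous (μ := (volume : Measure (mixedSpace K))) hk hgs
  refine hcont.congr fun ξ => ?_
  refine setIntegral_eq_integral_of_forall_compl_eq_zero fun x hx => ?_
  rw [image_eq_zero_of_notMem_tsupport hx, ofReal_zero, zero_mul]

/-! ### Place weights -/

variable (K) in
/-- **The place weight** `ξ ↦ ∏_w |ξ_w|_w^{m w}` on `K_∞`, valued in `ℝ≥0∞`. [folklore] -/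
def placeWeight (m : InfinitePlace K → ℕ) (ξ : mixedSpace K) : ℝ≥0∞ := ∏ w, ENNReal.ofReal (normAtPlace w ξ) ^ m w

/-- Place weights are multiplicative. [folklore] -/
theorem placeWeight_mul (m : InfinitePlace K → ℕ) (ξ ξ' : mixedSpace K) :
    placeWeight K m (ξ * ξ') = placeWeight K m ξ * placeWeight K m ξ' := by
  simp only [placeWeight, map_mul, ENNReal.ofReal_mul (normAtPlace_nonneg _ _), mul_pow, Finset.prod_mul_distrib]

/-- The place weight of `1` is `1`. [folklore] -/
@[simp]
theorem placeWeight_one (m : InfinitePlace K → ℕ) : placeWeight K m 1 = 1 := by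
  simp [placeWeight]

/-- Place weights are measurable. [folklore] -/
theorem measurable_placeWeight (m : InfinitePlace K → ℕ) : Measurable (placeWeight K m) := by
  refine Finset.measurable_prod _ fun w _ => ?_
  exact ((continuous_normAtPlace w).measurable.ennreal_ofReal).pow_const _

/-- The place weight as `ofReal` of the real monomial. [folklore] -/
theorem placeWeight_eq_ofReal (m : InfinitePlace K → ℕ) (ξ : mixedSpace K) :
    placeWeight K m ξ = ENNReal.ofReal (∏ w, normAtPlace w ξ ^ m w) := by
  rw [placeWeight, ENNReal.ofReal_prod_of_nonneg fun w _ => pow_nonneg (normAtPlace_nonneg _ _) _]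
  exact Finset.prod_congr rfl fun w _ => (ENNReal.ofReal_pow (normAtPlace_nonneg _ _) _).symm

/-! ### Finiteness of the dilation constant -/

/-- Pointwise inversion on `K_∞` is measurable (product of measurable inversions). [folklore] -/
instance : MeasurableInv (mixedSpace K) := ⟨(measurable_fst.inv).prodMk (measurable_snd.inv)⟩

omit [NumberField K] in
/-- `|x⁻¹|_w = |x|_w⁻¹` for the componentwise inverse on `K_∞`. [folklore] -/
theorem normAtPlace_inv (w : InfinitePlace K) (x : mixedSpace K) : normAtPlace w x⁻¹ = (normAtPlace w x)⁻¹ := by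
  rcases isReal_or_isComplex w with h | h
  · rw [normAtPlace_apply_of_isReal h, normAtPlace_apply_of_isReal h, Prod.fst_inv, Pi.inv_apply, norm_inv]
  · rw [normAtPlace_apply_of_isComplex h, normAtPlace_apply_of_isComplex h, Prod.snd_inv, Pi.inv_apply, norm_inv]

/-- **The one-variable estimate** behind the finiteness of the dilation constant: for `t > 0`,
`a + 1 ≤ 2k`, `d ≤ a + 2`:
`t^a (t^d)⁻¹ (min(1, t⁻¹)^k / max(1, t⁻¹))² ≤ 2^{d+1} ((1+t)^{d+1})⁻¹`. [folklore] -/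
theorem pow_mul_inv_mul_sq_le {t : ℝ} (ht : 0 < t) {a d k : ℕ} (hk : a + 1 ≤ 2 * k) (hd : d ≤ a + 2) :
    t ^ a * (t ^ d)⁻¹ * (min 1 t⁻¹ ^ k / max 1 t⁻¹) ^ 2 ≤ 2 ^ (d + 1) * ((1 + t) ^ (d + 1))⁻¹ := by
  have h1t : 0 < 1 + t := by linarith
  -- the common second step: `X ≤ 2^{d+1}/(1+t)^{d+1}` iff `X (1+t)^{d+1} ≤ 2^{d+1}`
  rw [le_mul_inv_iff₀ (pow_pos h1t _)]
  rcases le_or_gt 1 t with h | h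
  · -- `t ≥ 1`: `min(1,t⁻¹) = t⁻¹`, `max(1,t⁻¹) = 1`
    have hinv : t⁻¹ ≤ 1 := inv_le_one_of_one_le₀ h
    rw [min_eq_right hinv, max_eq_left hinv, div_one, ← pow_mul, inv_pow]
    -- `t^a t^{-d} t^{-2k} (1+t)^{d+1} ≤ t^a t^{-d} t^{-2k} (2t)^{d+1} = 2^{d+1} t^{a+1} / t^{2k} ≤ 2^{d+1}`
    have h2t : (1 + t) ^ (d + 1) ≤ (2 * t) ^ (d + 1) := pow_le_pow_left₀ h1t.le (by linarith) _
    calc t ^ a * (t ^ d)⁻¹ * (t ^ (k * 2))⁻¹ * (1 + t) ^ (d + 1)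
        ≤ t ^ a * (t ^ d)⁻¹ * (t ^ (k * 2))⁻¹ * (2 * t) ^ (d + 1) :=
          mul_le_mul_of_nonneg_left h2t (by positivity)
      _ = 2 ^ (d + 1) * (t ^ (a + (d + 1)) * (t ^ (d + k * 2))⁻¹) := by
          rw [mul_pow]; field_simp; ring
      _ ≤ 2 ^ (d + 1) * 1 := by
          refine mul_le_mul_of_nonneg_left ?_ (by positivity)
          rw [← div_eq_mul_inv, div_le_one (by positivity)]
          exact pow_le_pow_right₀ h (by omega)
      _ = 2 ^ (d + 1) := mul_one _
  · -- `t < 1`: `min(1,t⁻¹) = 1`, `max(1,t⁻¹) = t⁻¹`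
    have hinv : 1 ≤ t⁻¹ := (one_le_inv₀ ht).2 h.le
    rw [min_eq_left hinv, max_eq_right hinv, one_pow, one_div, inv_inv]
    have h2t : (1 + t) ^ (d + 1) ≤ 2 ^ (d + 1) := pow_le_pow_left₀ h1t.le (by linarith) _
    calc t ^ a * (t ^ d)⁻¹ * t ^ 2 * (1 + t) ^ (d + 1)
        ≤ t ^ a * (t ^ d)⁻¹ * t ^ 2 * 2 ^ (d + 1) := mul_le_mul_of_nonneg_left h2t (by positivity)
      _ = (t ^ (a + 2) * (t ^ d)⁻¹) * 2 ^ (d + 1) := by rw [pow_add]; ring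
      _ ≤ 1 * 2 ^ (d + 1) := by
          refine mul_le_mul_of_nonneg_right ?_ (by positivity)
          rw [← div_eq_mul_inv, div_le_one (by positivity)]
          exact pow_le_pow_of_le_one ht.le h.le hd
      _ = 2 ^ (d + 1) := one_mul _

/-- The dominating profile `x ↦ ∏_w 2^{d_w+1} ((1 + |x_w|_w)^{d_w+1})⁻¹` (`d_w = mult w`). [folklore] -/
def decayProfile (x : mixedSpace K) : ℝ := ∏ w, (2 : ℝ) ^ (mult w + 1) * ((1 + normAtPlace w x) ^ (mult w + 1))⁻¹

/-- The decay profile is non-negative. [folklore] -/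
theorem decayProfile_nonneg (x : mixedSpace K) : 0 ≤ decayProfile x :=
  Finset.prod_nonneg fun w _ => mul_nonneg (by positivity)
    (inv_nonneg.2 (pow_nonneg (add_nonneg zero_le_one (normAtPlace_nonneg _ _)) _))

/-- The one-dimensional factor `t ↦ (1+‖t‖)^{-(d+1)}` is integrable on a real normed space of
dimension `d`. [folklore] -/
theorem integrable_inv_one_add_norm_pow {E : Type*} [NormedAddCommGroup E] [NormedSpace ℝ E] [FiniteDimensional ℝ E]
    [MeasurableSpace E] [BorelSpace E] (μ : Measure E) [μ.IsAddHaarMeasure] {d : ℕ} (hd : Module.finrank ℝ E ≤ d) (c : ℝ) :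
    Integrable (fun t : E => c * ((1 + ‖t‖) ^ (d + 1))⁻¹) μ := by
  have h := (integrable_one_add_norm (μ := μ) (r := (d + 1 : ℕ)) (by exact_mod_cast Nat.lt_succ_of_le hd)).const_mul c
  refine h.congr (ae_of_all _ fun t => ?_)
  simp only [Real.rpow_neg (by positivity : (0 : ℝ) ≤ 1 + ‖t‖), Real.rpow_natCast]

/-- **The decay profile is integrable on `K_∞`** (product of integrable one-place factors). [folklore] -/
theorem integrable_decayProfile : Integrable (decayProfile (K := K)) := by
  -- split the product over real and complex places and use the product structure of `volume`
  have hsplit : (decayProfile (K := K)) = fun x =>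
      (∏ w : {w : InfinitePlace K // IsReal w}, (2 : ℝ) ^ 2 * ((1 + ‖x.1 w‖) ^ 2)⁻¹) *
        ∏ w : {w : InfinitePlace K // IsComplex w}, (2 : ℝ) ^ 3 * ((1 + ‖x.2 w‖) ^ 3)⁻¹ := by
    funext x
    rw [decayProfile, prod_eq_prod_mul_prod]
    congr 1
    · exact Finset.prod_congr rfl fun w _ => by rw [mult_isReal, normAtPlace_apply_of_isReal w.2]
    · exact Finset.prod_congr rfl fun w _ => by rw [mult_isComplex, normAtPlace_apply_of_isComplex w.2]
  rw [hsplit, MeasureTheory.Measure.volume_eq_prod]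
  refine Integrable.mul_prod (μ := (volume : Measure ({w : InfinitePlace K // IsReal w} → ℝ)))
    (ν := (volume : Measure ({w : InfinitePlace K // IsComplex w} → ℂ)))
    (f := fun y : {w : InfinitePlace K // IsReal w} → ℝ => ∏ w, (2 : ℝ) ^ 2 * ((1 + ‖y w‖) ^ 2)⁻¹)
    (g := fun y : {w : InfinitePlace K // IsComplex w} → ℂ => ∏ w, (2 : ℝ) ^ 3 * ((1 + ‖y w‖) ^ 3)⁻¹) ?_ ?_
  · rw [volume_pi]
    exact Integrable.fintype_prod (f := fun _ (t : ℝ) => (2 : ℝ) ^ 2 * ((1 + ‖t‖) ^ 2)⁻¹) fun _ =>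
      integrable_inv_one_add_norm_pow volume (by simp) _
  · rw [volume_pi]
    exact Integrable.fintype_prod (f := fun _ (t : ℂ) => (2 : ℝ) ^ 3 * ((1 + ‖t‖) ^ 3)⁻¹) fun _ =>
      integrable_inv_one_add_norm_pow volume (by simp [Complex.finrank_real_complex]) _

/-- **Pointwise domination on units**: for a kernel with place-wise decay at order `k`, weight exponents
`a` with `a w + 1 ≤ 2 k w` and `mult w ≤ a w + 2`, and a unit `x`,
`∏_w |x_w|^{a_w} · N(x)⁻¹ · ‖ĝ(x⁻¹)‖² ≤ C² · decayProfile x`. [cite: JacquetShalikaAJM1981, §4] -/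
theorem weight_mul_inv_norm_mul_sq_le {k a : InfinitePlace K → ℕ} {g : mixedSpace K → ℝ} {C : ℝ}
    (hC : ∀ ξ : mixedSpace K, ‖kernelTransform K g ξ‖ * ∏ w, max 1 (normAtPlace w ξ) ^ 1 ≤ C * ∏ w, min 1 (normAtPlace w ξ) ^ k w)
    (hk : ∀ w, a w + 1 ≤ 2 * k w) (ha : ∀ w, mult w ≤ a w + 2) {x : mixedSpace K} (hx : IsUnit x) :
    (∏ w, normAtPlace w x ^ a w) * (mixedEmbedding.norm x)⁻¹ * ‖kernelTransform K g x⁻¹‖ ^ 2 ≤ C ^ 2 * decayProfile x := by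
  have hpos : ∀ w, 0 < normAtPlace w x := fun w =>
    lt_of_le_of_ne (normAtPlace_nonneg _ _) (Ne.symm (mt (fun h => mixedEmbedding.norm_eq_zero_iff.2 ⟨w, h⟩)
      (norm_ne_zero_of_isUnit K hx)))
  -- the transform at `x⁻¹`
  have hM0 : 0 < ∏ w, max 1 (normAtPlace w x⁻¹) ^ 1 := Finset.prod_pos fun w _ => by positivity
  have hT : ‖kernelTransform K g x⁻¹‖ ≤ C * ∏ w, (min 1 (normAtPlace w x)⁻¹ ^ k w / max 1 (normAtPlace w x)⁻¹) := by
    have h := hC x⁻¹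
    rw [← le_div_iff₀ hM0] at h
    refine h.trans (le_of_eq ?_)
    rw [mul_div_assoc, ← Finset.prod_div_distrib]
    refine congrArg (C * ·) (Finset.prod_congr rfl fun w _ => ?_)
    rw [pow_one, normAtPlace_inv]
  have hT0 : 0 ≤ ‖kernelTransform K g x⁻¹‖ := norm_nonneg _
  have hP0 : 0 ≤ ∏ w, (min 1 (normAtPlace w x)⁻¹ ^ k w / max 1 (normAtPlace w x)⁻¹) :=
    Finset.prod_nonneg fun w _ => div_nonneg (pow_nonneg (le_min zero_le_one (inv_nonneg.2 (normAtPlace_nonneg _ _))) _)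
      (le_trans zero_le_one (le_max_left _ _))
  have hsq : ‖kernelTransform K g x⁻¹‖ ^ 2 ≤ C ^ 2 * (∏ w, (min 1 (normAtPlace w x)⁻¹ ^ k w / max 1 (normAtPlace w x)⁻¹)) ^ 2 := by
    rw [← mul_pow]
    exact pow_le_pow_left₀ hT0 hT 2
  -- assemble place by place
  rw [mixedEmbedding.norm_apply]
  calc (∏ w, normAtPlace w x ^ a w) * (∏ w, normAtPlace w x ^ mult w)⁻¹ * ‖kernelTransform K g x⁻¹‖ ^ 2
      ≤ (∏ w, normAtPlace w x ^ a w) * (∏ w, normAtPlace w x ^ mult w)⁻¹ *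
          (C ^ 2 * (∏ w, (min 1 (normAtPlace w x)⁻¹ ^ k w / max 1 (normAtPlace w x)⁻¹)) ^ 2) :=
        mul_le_mul_of_nonneg_left hsq (mul_nonneg (Finset.prod_nonneg fun w _ => pow_nonneg (normAtPlace_nonneg _ _) _)
          (inv_nonneg.2 (Finset.prod_nonneg fun w _ => pow_nonneg (normAtPlace_nonneg _ _) _)))
    _ = C ^ 2 * ∏ w, normAtPlace w x ^ a w * (normAtPlace w x ^ mult w)⁻¹ *
          (min 1 (normAtPlace w x)⁻¹ ^ k w / max 1 (normAtPlace w x)⁻¹) ^ 2 := by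
        rw [Finset.prod_mul_distrib, Finset.prod_mul_distrib, Finset.prod_inv_distrib, Finset.prod_pow]
        ring
    _ ≤ C ^ 2 * decayProfile x := by
        refine mul_le_mul_of_nonneg_left (Finset.prod_le_prod (fun w _ => ?_) fun w _ => ?_) (sq_nonneg C)
        · exact mul_nonneg (mul_nonneg (pow_nonneg (normAtPlace_nonneg _ _) _) (inv_nonneg.2 (pow_nonneg (normAtPlace_nonneg _ _) _)))
            (sq_nonneg _)
        · exact pow_mul_inv_mul_sq_le (hpos w) (hk w) (ha w)

attribute [local instance] Literature.MeasureTheory.Group.Units.borelSpace_of_isOpenEmbedding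
  Literature.MeasureTheory.Group.hasSummableGeomSeries_of_finiteDimensional

/-- **Finiteness of the dilation constant**: for a kernel with place-wise decay at order `k` (e.g. a
moment kernel, `IsMomentKernel.hasPlaceDecay`) and weight exponents `a` with `a w + 1 ≤ 2 k w`,
`mult w ≤ a w + 2`, the constant `∫_{K_∞ˣ} ∏_w |z_w|^{a_w} ‖ĝ(z⁻¹)‖² d^×z` of the dilation integral
(`lintegral_weight_mul_norm_sq_kirillovKernel_le`) is finite. [cite: JacquetShalikaAJM1981, §4] -/
theorem lintegral_placeWeight_mul_norm_sq_kernelTransform_inv_lt_top {k a : InfinitePlace K → ℕ} {g : mixedSpace K → ℝ}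
    (hgc : Continuous g) (hgs : HasCompactSupport g) (hdec : HasPlaceDecay K k g)
    (hk : ∀ w, a w + 1 ≤ 2 * k w) (ha : ∀ w, mult w ≤ a w + 2) :
    ∫⁻ z, placeWeight K a (z : mixedSpace K) *
        ENNReal.ofReal (‖kernelTransform K g (((z⁻¹ : (mixedSpace K)ˣ) : mixedSpace K))‖ ^ 2) ∂mixedUnitsHaar K < ⊤ := by
  obtain ⟨C, -, hC⟩ := hdec 1
  -- the integrand as a measurable function of `↑z`
  set G : mixedSpace K → ℝ≥0∞ := fun x => placeWeight K a x * ENNReal.ofReal (‖kernelTransform K g x⁻¹‖ ^ 2) with hG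
  have hGm : Measurable G := by
    refine (measurable_placeWeight a).mul (Measurable.ennreal_ofReal ?_)
    exact ((continuous_kernelTransform hgc hgs).measurable.comp measurable_inv).norm.pow_const _
  have hGeq : ∀ z : (mixedSpace K)ˣ, placeWeight K a (z : mixedSpace K) *
      ENNReal.ofReal (‖kernelTransform K g (((z⁻¹ : (mixedSpace K)ˣ) : mixedSpace K))‖ ^ 2) = G z := by
    intro z; simp only [hG, Units.val_inv_eq_inv_val]
  simp_rw [hGeq]
  rw [lintegral_mixedUnitsHaar K hGm]
  -- domination on units by `C² · decayProfile`
  have hdom : ∀ x ∈ {x : mixedSpace K | IsUnit x}, G x * (ENNReal.ofReal (mixedEmbedding.norm x))⁻¹ ≤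
      ENNReal.ofReal (C ^ 2 * decayProfile x) := by
    intro x hx
    have hNpos : 0 < mixedEmbedding.norm x := lt_of_le_of_ne (mixedEmbedding.norm_nonneg _) (norm_ne_zero_of_isUnit K hx).symm
    show placeWeight K a x * ENNReal.ofReal (‖kernelTransform K g x⁻¹‖ ^ 2) * (ENNReal.ofReal (mixedEmbedding.norm x))⁻¹ ≤ _
    rw [placeWeight_eq_ofReal, ← ENNReal.ofReal_inv_of_pos hNpos, ← ENNReal.ofReal_mul (Finset.prod_nonneg fun w _ =>
      pow_nonneg (normAtPlace_nonneg _ _) _), ← ENNReal.ofReal_mul (mul_nonneg (Finset.prod_nonneg fun w _ =>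
      pow_nonneg (normAtPlace_nonneg _ _) _) (sq_nonneg _))]
    refine ENNReal.ofReal_le_ofReal ?_
    calc (∏ w, normAtPlace w x ^ a w) * ‖kernelTransform K g x⁻¹‖ ^ 2 * (mixedEmbedding.norm x)⁻¹
        = (∏ w, normAtPlace w x ^ a w) * (mixedEmbedding.norm x)⁻¹ * ‖kernelTransform K g x⁻¹‖ ^ 2 := by ring
      _ ≤ C ^ 2 * decayProfile x := weight_mul_inv_norm_mul_sq_le hC hk ha hx
  calc ∫⁻ x in {x : mixedSpace K | IsUnit x}, G x * (ENNReal.ofReal (mixedEmbedding.norm x))⁻¹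
      ≤ ∫⁻ x in {x : mixedSpace K | IsUnit x}, ENNReal.ofReal (C ^ 2 * decayProfile x) :=
        setLIntegral_mono' Units.isOpen.measurableSet hdom
    _ ≤ ∫⁻ x, ENNReal.ofReal (C ^ 2 * decayProfile x) := setLIntegral_le_lintegral _ _
    _ < ⊤ := by
        have hi := (integrable_decayProfile (K := K)).const_mul (C ^ 2)
        exact (hasFiniteIntegral_iff_ofReal (ae_of_all _ fun x => mul_nonneg (sq_nonneg C) (decayProfile_nonneg x))).1 hi.2

/-- **Finiteness of the dilation constant for moment kernels** of order `≥ M` with `M ≥ m + 1`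
pointwise... stated with the even weight exponents `2 m` of the Kirillov bound: for
`m w + 1 ≤ k w` everywhere. [cite: JacquetShalikaAJM1981, §4] -/
theorem IsMomentKernel.lintegral_dilationConstant_lt_top {k m : InfinitePlace K → ℕ}
    {g : mixedSpace K → ℝ} (hg : IsMomentKernel K k g) (hkm : ∀ w, m w + 1 ≤ k w) :
    ∫⁻ z, placeWeight K (2 • m) (z : mixedSpace K) *
        ENNReal.ofReal (‖kernelTransform K g (((z⁻¹ : (mixedSpace K)ˣ) : mixedSpace K))‖ ^ 2) ∂mixedUnitsHaar K < ⊤ := by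
  refine lintegral_placeWeight_mul_norm_sq_kernelTransform_inv_lt_top hg.continuous hg.hasCompactSupport hg.hasPlaceDecay
    (fun w => ?_) (fun w => ?_)
  · simp only [Pi.smul_apply, smul_eq_mul]; have := hkm w; omega
  · simp only [Pi.smul_apply, smul_eq_mul]; have := mult_pos (w := w); have := hkm w
    rcases isReal_or_isComplex w with h | h
    · rw [mult, if_pos h]; omega
    · rw [mult, if_neg (not_isReal_iff_isComplex.2 h)]; omega


/-! ### Existence of admissible kernels with `ĝ(1) ≠ 0` -/

/-- Iterated pure derivatives raise the order: `∂_e^M` at the place `w`. [folklore] -/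
theorem IsMomentKernel.iterDirDeriv {k : InfinitePlace K → ℕ} {g : mixedSpace K → ℝ} {w : InfinitePlace K} {e : mixedSpace K}
    (he : IsPureDir K w e) (hg : IsMomentKernel K k g) :
    ∀ M : ℕ, IsMomentKernel K (k + M • Pi.single w 1 : InfinitePlace K → ℕ) (iterDirDeriv e M g)
  | 0 => by rw [zero_nsmul, add_zero]; exact hg
  | M + 1 => by
    have h := (IsMomentKernel.iterDirDeriv he hg M).deriv w he
    have hk : (k + M • Pi.single w 1 : InfinitePlace K → ℕ) + Pi.single w 1 = k + (M + 1) • Pi.single w 1 := by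
      rw [succ_nsmul, add_assoc]
    rw [hk] at h
    exact h

/-- A bump around `0 ∈ K_∞` whose transform at `1` has positive real part. [folklore] -/
theorem exists_bump_re_kernelTransform_one_pos :
    ∃ h : mixedSpace K → ℝ, ContDiff ℝ ∞ h ∧ HasCompactSupport h ∧ 0 < (kernelTransform K h 1).re := by
  -- radius: `|B(1, x)| ≤ ‖B(1, ·)‖ ‖x‖ ≤ π / 3` on the support
  set L : ℝ := ‖archCharFormCLM K 1‖ with hL
  have hL0 : 0 ≤ L := norm_nonneg _
  set r : ℝ := (π / 3) / (L + 1) with hr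
  have hr0 : 0 < r := div_pos (by positivity) (by linarith)
  let b : ContDiffBump (0 : mixedSpace K) := ⟨r / 2, r, by positivity, by linarith⟩
  refine ⟨b, b.contDiff, b.hasCompactSupport, ?_⟩
  -- `Re ĥ(1) = ∫ h cos(B(1, x)) ≥ (1/2) ∫ h > 0`
  have hint : Integrable fun x => ((b x : ℝ) : ℂ) * archChar K 1 x :=
    integrable_kernelTransform_integrand K b.continuous b.hasCompactSupport 1
  have hre : (kernelTransform K b 1).re = ∫ x, b x * Real.cos (archCharForm K 1 x) := by
    have h := integral_re hint
    rw [RCLike.re_to_complex] at h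
    rw [kernelTransform, ← h]
    refine integral_congr_ae (ae_of_all _ fun x => ?_)
    show RCLike.re (((b x : ℝ) : ℂ) * archChar K 1 x) = b x * Real.cos (archCharForm K 1 x)
    rw [RCLike.re_to_complex, Complex.re_ofReal_mul, archChar, exp_ofReal_mul_I_re]
  rw [hre]
  have hcos : ∀ x, b x * (1 / 2) ≤ b x * Real.cos (archCharForm K 1 x) := by
    intro x
    by_cases hx : x ∈ Metric.ball (0 : mixedSpace K) r
    · refine mul_le_mul_of_nonneg_left ?_ b.nonneg
      have hBx : |archCharForm K 1 x| ≤ π / 3 := by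
        have h1 : |archCharForm K 1 x| ≤ L * ‖x‖ := by
          rw [← Real.norm_eq_abs]; exact (archCharFormCLM K 1).le_opNorm x
        have h2 : ‖x‖ < r := by simpa using hx
        calc |archCharForm K 1 x| ≤ L * ‖x‖ := h1
          _ ≤ L * r := mul_le_mul_of_nonneg_left h2.le hL0
          _ ≤ (L + 1) * r := mul_le_mul_of_nonneg_right (by linarith) hr0.le
          _ = π / 3 := by rw [hr]; field_simp
      rw [← Real.cos_pi_div_three, ← Real.cos_abs (archCharForm K 1 x)]
      exact Real.cos_le_cos_of_nonneg_of_le_pi (abs_nonneg _) (by linarith [Real.pi_pos]) hBx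
    · have h0 : b x = 0 := by
        have : x ∉ Function.support (b : mixedSpace K → ℝ) := by rw [b.support_eq]; exact hx
        simpa [Function.mem_support] using this
      rw [h0, zero_mul, zero_mul]
  have hI : Integrable fun x => b x * Real.cos (archCharForm K 1 x) :=
    (b.continuous.mul (Real.continuous_cos.comp (archCharFormCLM K 1).continuous)).integrable_of_hasCompactSupport
      b.hasCompactSupport.mul_right
  calc (0 : ℝ) < (∫ x, b x) * (1 / 2) := mul_pos b.integral_pos (by norm_num)
    _ = ∫ x, b x * (1 / 2) := (integral_mul_const _ _).symm
    _ ≤ ∫ x, b x * Real.cos (archCharForm K 1 x) := integral_mono (b.integrable.mul_const _) hI hcos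

/-- A place-pure coordinate direction at `w` with `B(1, e) ≠ 0`. [folklore] -/
theorem exists_isPureDir_archCharForm_one_ne_zero (w : InfinitePlace K) :
    ∃ e : mixedSpace K, IsPureDir K w e ∧ archCharForm K 1 e ≠ 0 := by
  rcases isReal_or_isComplex w with hw | hw
  · refine ⟨((Pi.single ⟨w, hw⟩ 1, 0) : mixedSpace K), fun b hb => ?_, ?_⟩
    · rcases b with w' | ⟨w', i⟩
      · rw [stdBasis_apply_isReal]
        have hne : w' ≠ ⟨w, hw⟩ := fun h => hb (by rw [indexPlace, h])
        simp [hne]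
      · match i with
        | 0 => rw [stdBasis_apply_isComplex_fst]; simp
        | 1 => rw [stdBasis_apply_isComplex_snd]; simp
    · rw [archCharForm_apply, mixedTrace_mul_single_real, Prod.fst_one, Pi.one_apply, mul_one]
      exact neg_ne_zero.2 (by positivity)
  · refine ⟨((0, Pi.single ⟨w, hw⟩ 1) : mixedSpace K), fun b hb => ?_, ?_⟩
    · rcases b with w' | ⟨w', i⟩
      · rw [stdBasis_apply_isReal]; simp
      · have hne : w' ≠ ⟨w, hw⟩ := fun h => hb (by rw [indexPlace, h])
        match i with
        | 0 => rw [stdBasis_apply_isComplex_fst]; simp [hne]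
        | 1 => rw [stdBasis_apply_isComplex_snd]; simp [hne]
    · rw [archCharForm_apply, mixedTrace_mul_single_complex, Prod.snd_one, Pi.one_apply, one_mul, Complex.one_re]
      exact mul_ne_zero (neg_ne_zero.2 (by positivity)) (by norm_num)

/-- The kernel obtained from `h` by `M` pure derivatives at each place of a list. [folklore] -/
def placeDerivKernel (e : InfinitePlace K → mixedSpace K) (M : ℕ) : List (InfinitePlace K) → (mixedSpace K → ℝ) → (mixedSpace K → ℝ)
  | [], h => h
  | w :: l, h => iterDirDeriv (e w) M (placeDerivKernel e M l h)

/-- The exponent bookkeeping of `placeDerivKernel`. [folklore] -/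
def placeDerivExpo (M : ℕ) : List (InfinitePlace K) → (InfinitePlace K → ℕ)
  | [] => 0
  | w :: l => placeDerivExpo M l + M • Pi.single w 1

/-- `placeDerivKernel` of a `C_c^∞` function is a moment kernel with exponent `placeDerivExpo`. [folklore] -/
theorem isMomentKernel_placeDerivKernel {e : InfinitePlace K → mixedSpace K} (he : ∀ w, IsPureDir K w (e w)) (M : ℕ)
    {h : mixedSpace K → ℝ} (hs : ContDiff ℝ ∞ h) (hc : HasCompactSupport h) :
    ∀ l : List (InfinitePlace K), IsMomentKernel K (placeDerivExpo M l) (placeDerivKernel e M l h)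
  | [] => IsMomentKernel.base hs hc
  | w :: l => (isMomentKernel_placeDerivKernel he M hs hc l).iterDirDeriv (he w) M

omit [NumberField K] in
/-- The exponent is `≥ M` at every listed place. [folklore] -/
theorem le_placeDerivExpo (M : ℕ) : ∀ (l : List (InfinitePlace K)) {w : InfinitePlace K}, w ∈ l → M ≤ placeDerivExpo M l w
  | [], w, hw => by simp at hw
  | w' :: l, w, hw => by
    rw [placeDerivExpo, Pi.add_apply]
    rcases List.mem_cons.1 hw with rfl | hw'
    · simp
    · exact (le_placeDerivExpo M l hw').trans (Nat.le_add_right _ _)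

/-- The transform of `placeDerivKernel` at `1`: a product of the factors `(-iB(1, e_w))^M` times `ĥ(1)`.
[folklore] -/
theorem kernelTransform_placeDerivKernel_one {e : InfinitePlace K → mixedSpace K} (he : ∀ w, IsPureDir K w (e w)) (M : ℕ)
    {h : mixedSpace K → ℝ} (hs : ContDiff ℝ ∞ h) (hc : HasCompactSupport h) :
    ∀ l : List (InfinitePlace K), kernelTransform K (placeDerivKernel e M l h) 1 =
      (l.map fun w => (-(((archCharForm K 1 (e w) : ℝ) : ℂ) * I)) ^ M).prod * kernelTransform K h 1
  | [] => by simp [placeDerivKernel]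
  | w :: l => by
    have hk := isMomentKernel_placeDerivKernel he M hs hc l
    rw [placeDerivKernel, kernelTransform_iterDirDeriv (e w) hk.contDiff hk.hasCompactSupport 1 M,
      kernelTransform_placeDerivKernel_one he M hs hc l, List.map_cons, List.prod_cons, mul_assoc]

/-- **Existence of admissible kernels**: for every order `M` there is a moment kernel `g` of order
`≥ M` at every place with `ĝ(1) ≠ 0` — so that the Whittaker functional is recovered from the
smoothing `ρ(g)` along the archimedean unipotent line: `Λ(ρ(g) v) = ĝ(1) Λ(v)`.
[cite: JacquetShalikaAJM1981, §4] -/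
theorem exists_isMomentKernelGE_kernelTransform_one_ne_zero (M : ℕ) :
    ∃ g : mixedSpace K → ℝ, IsMomentKernelGE K M g ∧ kernelTransform K g 1 ≠ 0 := by
  obtain ⟨h, hs, hc, hre⟩ := exists_bump_re_kernelTransform_one_pos (K := K)
  choose e he hB using exists_isPureDir_archCharForm_one_ne_zero (K := K)
  set l : List (InfinitePlace K) := (Finset.univ : Finset (InfinitePlace K)).toList with hl
  refine ⟨placeDerivKernel e M l h, ⟨placeDerivExpo M l, fun w => le_placeDerivExpo M l ?_, isMomentKernel_placeDerivKernel he M hs hc l⟩, ?_⟩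
  · rw [hl, Finset.mem_toList]; exact Finset.mem_univ w
  · rw [kernelTransform_placeDerivKernel_one he M hs hc l]
    refine mul_ne_zero (List.prod_ne_zero fun hmem => ?_) (fun h0 => hre.ne' (by rw [h0, Complex.zero_re]))
    obtain ⟨w, -, hw⟩ := List.mem_map.1 hmem
    exact pow_ne_zero M (neg_ne_zero.2 (mul_ne_zero (ofReal_ne_zero.2 (hB w)) I_ne_zero)) hw

end Literature.NumberTheory.Automorphic
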